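import Literature.AnabelianGeometry.AbsoluteAnabelian.AbsTopIII.FunctionFieldSlimSubpadicProofs
import Literature.AnabelianGeometry.AbsoluteAnabelian.GeneralizedSubpadicSlimProofs
import Literature.AnabelianGeometry.AbsoluteAnabelian.SubpadicFGExtension
import HarnessLib

/-!
# [AbsTopIII] Theorem 1.11, slimness — the GENERALIZED sub-`p`-adic case

Proof-only companion to `AbsTopIII/BirationalReconstruction.lean` and
`FunctionFieldSlimSubpadicProofs.lean`.  S. Mochizuki, *Topics in absolute anabelian geometry III*,
Thm. 1.11 p. 45 ("`Δ_{η_X}`, `Π_{η_X}`, and `G_k` are slim"), whose sub-`p`-adic case is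
`Thm_1_11_slim_subpadic`; that file's docstring notes "For a generalized sub-`p`-adic `k`, conjunct (c)
is `Tpcs.lem_4_14_slim_holds`; conjunct (a) would need the closure of that class under finitely
generated extensions, not assembled here."  The closure is now `IsGeneralizedSubpadicFor.of_essFiniteType`
(`SubpadicFGExtension.lean`), so the generalized sub-`p`-adic case assembles: the function field
`K = K_X` of a curve over a generalized sub-`p`-adic `k` ([Tpcs] = *Topics surrounding the anabelian
geometry of hyperbolic curves* (2003), Def. 4.11 p. 44) is itself generalized sub-`p`-adic, so `Π_{η_X}
= Gal(K̄/K)` is slim by [Tpcs] Lem. 4.14 p. 48 (`IsGeneralizedSubpadicFor.isSlimGroup_absoluteGaloisGroup`),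
`Δ_{η_X}` is slim in characteristic zero (`isSlimGroup_geom_genericPointExtension`), and `G_k` is slim
by Lem. 4.14 again.  HONEST FRAMING: generalized sub-`p`-adic fields need not be Kummer-faithful
([AbsTopIII] Rmk. 1.5.4 (iv)), so this is not an instance of the printed Thm. 1.11 but the parallel
statement over the base fields of [Tpcs] §4; classical, kernel-checked; nothing here bears on
[IUTchIII] Cor. 3.12. [cite: MochizukiTopics2003, Lem 4.14 p.48] [cite: MochizukiAbsTopIII2015, Thm 1.11 p.45]
-/

noncomputable section

open scoped Classical

namespace Literature.AnabelianGeometry.AbsoluteAnabelian.AbsTopIII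

open Field
open Literature.NumberTheory.GaloisRepresentations (absGaloisRestrict)
open Literature.NumberTheory.DiophantineGeometry
open Literature.AlgebraicGeometry.Frobenioids (IsSlimGroup)

universe u

/-- **The function field of a curve over a generalized sub-`p`-adic field is generalized
sub-`p`-adic** (it is finitely generated over `k`; [Tpcs] Def. 4.11 p. 44 with
`IsGeneralizedSubpadicFor.of_essFiniteType`). [cite: MochizukiTopics2003, Def 4.11 p.44] -/
theorem IsGeneralizedSubpadicFor.of_isAlgFunctionField (k K : Type u) [Field k] [Field K]
    [Algebra k K] [IsAlgFunctionField k K] {p : ℕ} [Fact p.Prime]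
    (hk : IsGeneralizedSubpadicFor k p) : IsGeneralizedSubpadicFor K p := by
  haveI : Algebra.EssFiniteType k K :=
    IntermediateField.fg_top_iff.mp (IsAlgFunctionField.fg_top (K := k) (F := K))
  exact hk.of_essFiniteType

/-- **The function field of a curve over a sub-`p`-adic field is sub-`p`-adic** ([pGC] Def. 15.4 (i)
p. 77 with `IsSubpadic.of_essFiniteType`). [cite: MochizukiLocAn1999, Def 15.4 (i) p.77] -/
theorem IsSubpadic.of_isAlgFunctionField (k K : Type u) [Field k] [Field K] [Algebra k K]
    [IsAlgFunctionField k K] (hk : IsSubpadic k) : IsSubpadic K := by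
  haveI : Algebra.EssFiniteType k K :=
    IntermediateField.fg_top_iff.mp (IsAlgFunctionField.fg_top (K := k) (F := K))
  exact hk.of_essFiniteType

/-- **[AbsTopIII] Theorem 1.11, slimness, over a GENERALIZED sub-`p`-adic base field — PROVED**: for an
algebraic function field of one variable `K/k` (`k` of characteristic zero, algebraically closed in
`K`, `Gal(K̄/K) → Gal(k̄/k)` surjective) with `k` generalized sub-`p`-adic, `Π_{η_X} = Gal(K̄/K)`,
`Δ_{η_X}` and `G_k` are slim: `K` is generalized sub-`p`-adic (`IsGeneralizedSubpadicFor.of_isAlgFunctionField`),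
so (a) and (c) are [Tpcs] Lem. 4.14, and (b) is `isSlimGroup_geom_genericPointExtension`.
[cite: MochizukiTopics2003, Lem 4.14 p.48] [cite: MochizukiAbsTopIII2015, Thm 1.11 p.45] -/
theorem Thm_1_11_slim_generalizedSubpadic (k K : Type u) [Field k] [CharZero k] [Field K]
    [CharZero K] [Algebra k K] [IsAlgFunctionField k K] [IsIntegrallyClosedIn k K]
    (hsurj : Function.Surjective (absGaloisRestrict k K)) {p : ℕ} [Fact p.Prime]
    (hk : IsGeneralizedSubpadicFor k p) :
    IsSlimGroup (Field.absoluteGaloisGroup K)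
      ∧ IsSlimGroup (genericPointExtension k K hsurj).geom
      ∧ IsSlimGroup (Field.absoluteGaloisGroup k) :=
  ⟨Literature.AnabelianGeometry.AbsoluteAnabelian.IsGeneralizedSubpadicFor.isSlimGroup_absoluteGaloisGroup
      (IsGeneralizedSubpadicFor.of_isAlgFunctionField k K hk),
    isSlimGroup_geom_genericPointExtension k K hsurj,
    Literature.AnabelianGeometry.AbsoluteAnabelian.IsGeneralizedSubpadicFor.isSlimGroup_absoluteGaloisGroup
      hk⟩

end Literature.AnabelianGeometry.AbsoluteAnabelian.AbsTopIII

end
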